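import Mathlib
import Summits.NavierStokesRegularity.NavierStokesRegularity.Theorems.EulerZoomLiouvillePowerGaugeEulerLiouvilleBallisticFreeFlight
import HarnessLib

/-!
# Crux E `PowerGaugeEulerLiouville` (stmt-NavierStokesRegularity-19832): THE TWO LIVE SIGNATURES OF `Cruxes/…/BallisticFaces.lean` (REV2)
# — B4 `Sig.perihelionLaw` (strict, backward arcs) and B5 `Sig.freeFlight` (closed arcs) — BODIES VERBATIM (width seat ns-ezl-w3 g5, T1 base)

Route №10 `EulerZoomLiouville` (NavierStokesRegularity), crux E; crux idea «ballistic-faces» (ns-idea-11 g7).  REV2 of the ideator's typed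
companion closed B1–B3 by name over `…BallisticOrbitIdentities` (p666351) and left two signatures live; this file proves both in their exact
binder shape (with `V`, `P'` for the profile, `E3 = EuclideanSpace ℝ (Fin 3)` spelled out):

* `perihelionLaw_strict_backward` = `Sig.perihelionLaw`: along a global BACKWARD orbit `Y′ = −W(Y)`, a radial turning point
  `⟪Y σ₀, W(Y σ₀)⟫ = 0` with sub-virial radial pressure force is a STRICT local minimum of `‖Y‖` (second-derivative test made strict by the
  mean value theorem on the sign of `d/dσ ½‖Y‖²` near `σ₀`);
* `freeFlight_Icc` = `Sig.freeFlight`: on a closed arc `[0, σ₁]` of a forward orbit with `∇P′(Y) = 0`,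
  `Y σ = e^{γσ}(Y 0 + V (Y 0)) − e^{(γ−1)σ} V (Y 0)` (the two first-order modes are constant on the convex arc).

Wiring (files only, the ideator's): `theorem perihelionLaw_holds : Sig.perihelionLaw := …Ballistic.perihelionLaw_strict_backward`,
`theorem freeFlight_holds : Sig.freeFlight := …Ballistic.freeFlight_Icc`.
WHAT THIS IS NOT: not NS regularity, not the crux E, no stub — portrait identities; `--supports` stmt-19832; 19832 OPEN; not E.
[cite: ConstantinIgnatovaVicol2026Putative, §3.1.1 eq. (3.3), §3.4 eq. (3.19)]
-/

noncomputable section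

-- flat `Theorems/<Route><Decl>…` files of one crux share the namespace of the crux (tree convention: `Summit.<S>.<S>.…`)
set_option linter.dupNamespace false

open Set Filter Topology InnerProductSpace Metric
open scoped RealInnerProductSpace

namespace Summit.NavierStokesRegularity.NavierStokesRegularity.Theorems.PowerGaugeEulerLiouville

namespace Ballistic

open Literature.Analysis Literature.Analysis.FluidPDE

/-! ### B4, strict and backward -/

/-- Radial speed along a BACKWARD orbit: `Y′ = −W(Y)` ⇒ `d/dσ ½|Y|² = −⟪Y, W(Y)⟫`. [folklore] -/
theorem hasDerivAt_half_norm_sq_backwardOrbit {γ : ℝ} {V : EuclideanSpace ℝ (Fin 3) → EuclideanSpace ℝ (Fin 3)}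
    {Y : ℝ → EuclideanSpace ℝ (Fin 3)} {σ : ℝ} (hY : HasDerivAt Y (-(selfSimilarTransport γ 0 V (Y σ))) σ) :
    HasDerivAt (fun s => (1 / 2 : ℝ) * ‖Y s‖ ^ 2) (-⟪Y σ, selfSimilarTransport γ 0 V (Y σ)⟫) σ := by
  have h := (hY.inner ℝ hY).const_mul (1 / 2 : ℝ)
  have e : (fun s => (1 / 2 : ℝ) * ⟪Y s, Y s⟫) = fun s => (1 / 2 : ℝ) * ‖Y s‖ ^ 2 := by
    funext s; rw [real_inner_self_eq_norm_sq]
  rw [e] at h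
  refine h.congr_deriv ?_
  rw [inner_neg_left, inner_neg_right, real_inner_comm]; ring

/-- **(B4) THE PERIHELION LAW, STRICT FORM ON BACKWARD ARCS** (`Sig.perihelionLaw` of `Cruxes/PowerGaugeEulerLiouville/BallisticFaces.lean`, body
verbatim): along a global backward orbit `Y′ = −W(Y)`, a radial turning point with sub-virial radial pressure force is a STRICT local minimum of
the radius. [folklore] -/
theorem perihelionLaw_strict_backward :
    ∀ (γ : ℝ) (V : EuclideanSpace ℝ (Fin 3) → EuclideanSpace ℝ (Fin 3)) (P' : EuclideanSpace ℝ (Fin 3) → ℝ),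
      IsSelfSimilarEulerProfile γ 0 V P' →
    ∀ (Y : ℝ → EuclideanSpace ℝ (Fin 3)) (σ₀ : ℝ), (∀ σ : ℝ, HasDerivAt Y (-(selfSimilarTransport γ 0 V (Y σ))) σ) →
      inner ℝ (Y σ₀) (selfSimilarTransport γ 0 V (Y σ₀)) = 0 →
      inner ℝ (Y σ₀) (gradient P' (Y σ₀)) < ‖selfSimilarTransport γ 0 V (Y σ₀)‖ ^ 2 + γ * (1 - γ) * ‖Y σ₀‖ ^ 2 →
        ∃ ε > 0, ∀ σ : ℝ, σ ≠ σ₀ → |σ - σ₀| < ε → ‖Y σ₀‖ < ‖Y σ‖ := by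
  intro γ V P' h Y σ₀ hY hturn hsub
  -- `g = ½‖Y‖²`, `g′ = −⟪Y, W(Y)⟫`, `g″(σ₀) > 0`
  set g : ℝ → ℝ := fun s => (1 / 2 : ℝ) * ‖Y s‖ ^ 2 with hg
  set g' : ℝ → ℝ := fun s => -⟪Y s, selfSimilarTransport γ 0 V (Y s)⟫ with hg'
  have hgd : ∀ s, HasDerivAt g (g' s) s := fun s => hasDerivAt_half_norm_sq_backwardOrbit (hY s)
  have hY' : ∀ s, HasDerivAt Y ((-1 : ℝ) • selfSimilarTransport γ 0 V (Y s)) s := fun s => by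
    simpa only [neg_one_smul] using hY s
  have hg'd : ∀ s, HasDerivAt g'
      (‖selfSimilarTransport γ 0 V (Y s)‖ ^ 2 + (2 * γ - 1) * ⟪Y s, selfSimilarTransport γ 0 V (Y s)⟫ +
        γ * (1 - γ) * ‖Y s‖ ^ 2 - ⟪Y s, gradient P' (Y s)⟫) s := fun s => by
    have h1 := (hasDerivAt_inner_transport_backwardOrbit h (hY' s)).neg
    simp only [neg_neg] at h1
    exact h1
  have hpos : deriv g' σ₀ > 0 := by
    rw [(hg'd σ₀).deriv, hturn, mul_zero, add_zero]; linarith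
  have hzero : g' σ₀ = 0 := by simp only [hg', hturn, neg_zero]
  -- the sign of `g′` near `σ₀`
  have hsign := eventually_nhdsWithin_sign_eq_of_deriv_pos hpos hzero
  obtain ⟨ε, hε, hball⟩ := Metric.eventually_nhds_iff.1 hsign
  refine ⟨ε, hε, fun σ hσ hσε => ?_⟩
  have hdist : ∀ s, |s - σ₀| < ε → SignType.sign (g' s) = SignType.sign (s - σ₀) := fun s hs => hball (by rwa [Real.dist_eq])
  -- compare `g σ₀ < g σ` by the mean value theorem on the segment between them
  have hlt : g σ₀ < g σ := by
    rcases lt_or_gt_of_ne hσ with hlt | hgt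
    · -- `σ < σ₀`: `g′ < 0` on `(σ, σ₀)`
      obtain ⟨ξ, hξ, hslope⟩ := exists_hasDerivAt_eq_slope g g' hlt
        (fun s _ => (hgd s).continuousAt.continuousWithinAt) (fun s _ => hgd s)
      have hξε : |ξ - σ₀| < ε := by
        rw [abs_lt]; constructor <;> [linarith [hξ.1, hξ.2, abs_lt.1 hσε]; linarith [hξ.2]]
      have hneg : g' ξ < 0 := by
        have hs := hdist ξ hξε
        rw [sign_neg (by linarith [hξ.2] : ξ - σ₀ < 0)] at hs
        exact sign_eq_neg_one_iff.1 hs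
      have : (g σ₀ - g σ) / (σ₀ - σ) < 0 := by rw [← hslope]; exact hneg
      have hden : 0 < σ₀ - σ := by linarith
      have := (div_neg_iff.1 this).resolve_left (fun h' => absurd h'.2 (not_lt.2 hden.le))
      linarith [this.1]
    · -- `σ₀ < σ`: `g′ > 0` on `(σ₀, σ)`
      obtain ⟨ξ, hξ, hslope⟩ := exists_hasDerivAt_eq_slope g g' hgt
        (fun s _ => (hgd s).continuousAt.continuousWithinAt) (fun s _ => hgd s)
      have hξε : |ξ - σ₀| < ε := by
        rw [abs_lt]; constructor <;> [linarith [hξ.1]; linarith [hξ.1, hξ.2, (abs_lt.1 hσε).2]]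
      have hposξ : 0 < g' ξ := by
        have hs := hdist ξ hξε
        rw [sign_pos (by linarith [hξ.1] : 0 < ξ - σ₀)] at hs
        exact sign_eq_one_iff.1 hs
      have : 0 < (g σ - g σ₀) / (σ - σ₀) := by rw [← hslope]; exact hposξ
      have hden : 0 < σ - σ₀ := by linarith
      have := (div_pos_iff.1 this).resolve_right (fun h' => absurd h'.2 (not_lt.2 hden.le))
      linarith [this.1]
  -- `½‖Y σ₀‖² < ½‖Y σ‖²` ⇒ `‖Y σ₀‖ < ‖Y σ‖`
  simp only [hg] at hlt
  nlinarith [norm_nonneg (Y σ₀), norm_nonneg (Y σ)]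

/-! ### B5 on closed arcs -/

/-- A function with zero derivative at every point of `[0, σ₁]` is constant there. [folklore] -/
theorem eq_of_hasDerivAt_zero_Icc {F : ℝ → EuclideanSpace ℝ (Fin 3)} {σ₁ : ℝ}
    (hF : ∀ s ∈ Icc (0 : ℝ) σ₁, HasDerivAt F 0 s) {σ : ℝ} (hσ : σ ∈ Icc (0 : ℝ) σ₁) : F σ = F 0 := by
  rcases eq_or_lt_of_le hσ.1 with h0 | h0
  · rw [← h0]
  · have hσ₁ : 0 < σ₁ := h0.trans_le hσ.2
    refine (convex_Icc (0 : ℝ) σ₁).is_const_of_fderivWithin_eq_zero (𝕜 := ℝ)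
      (fun s hs => (hF s hs).differentiableAt.differentiableWithinAt) (fun s hs => ?_) hσ (left_mem_Icc.2 hσ₁.le)
    rw [(hF s hs).hasFDerivAt.hasFDerivWithinAt.fderivWithin (uniqueDiffOn_Icc hσ₁ s hs)]
    ext v; simp

/-- **(B5) FREE FLIGHT ON A CLOSED ARC** (`Sig.freeFlight` of `Cruxes/PowerGaugeEulerLiouville/BallisticFaces.lean`, body verbatim): on `[0, σ₁]`
along a forward orbit with `∇P′(Y) = 0`, `Y σ = e^{γσ}(Y 0 + V (Y 0)) − e^{(γ−1)σ} V (Y 0)`. [folklore] -/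
theorem freeFlight_Icc :
    ∀ (γ : ℝ) (V : EuclideanSpace ℝ (Fin 3) → EuclideanSpace ℝ (Fin 3)) (P' : EuclideanSpace ℝ (Fin 3) → ℝ),
      IsSelfSimilarEulerProfile γ 0 V P' →
    ∀ (Y : ℝ → EuclideanSpace ℝ (Fin 3)) (σ₁ : ℝ), 0 ≤ σ₁ →
      (∀ σ ∈ Set.Icc 0 σ₁, HasDerivAt Y (selfSimilarTransport γ 0 V (Y σ)) σ) →
      (∀ σ ∈ Set.Icc 0 σ₁, gradient P' (Y σ) = 0) →
        ∀ σ ∈ Set.Icc 0 σ₁,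
          Y σ = Real.exp (γ * σ) • (Y 0 + V (Y 0)) - Real.exp ((γ - 1) * σ) • V (Y 0) := by
  intro γ V P' h Y σ₁ _ hY hfree σ hσ
  -- drift mode `e^{−γs}(Y + V(Y))` and fall mode `e^{(1−γ)s}V(Y)` have zero derivative on the arc
  have hdrift : ∀ r ∈ Icc (0 : ℝ) σ₁, HasDerivAt (fun r => Real.exp (-(γ * r)) • (Y r + V (Y r))) 0 r := by
    intro r hr
    have hZ : HasDerivAt (fun r => Y r + V (Y r)) (γ • (Y r + V (Y r))) r := by
      have h1 := (hY r hr).add (hasDerivAt_velocity_orbit h (hY r hr))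
      rw [hfree r hr, sub_zero] at h1
      refine h1.congr_deriv ?_
      rw [selfSimilarTransport_apply, sub_zero, smul_add]
      module
    have hexp : HasDerivAt (fun r : ℝ => Real.exp (-(γ * r))) (-γ * Real.exp (-(γ * r))) r := by
      have h1 := ((hasDerivAt_id r).const_mul (-γ)).exp
      simp only [id, mul_one, neg_mul] at h1
      convert h1 using 1; ring
    refine (hexp.smul hZ).congr_deriv ?_
    rw [smul_smul]
    have : Real.exp (-(γ * r)) * γ = -(-γ * Real.exp (-(γ * r))) := by ring
    rw [this, neg_smul, neg_add_cancel]
  have hfall : ∀ r ∈ Icc (0 : ℝ) σ₁, HasDerivAt (fun r => Real.exp ((1 - γ) * r) • V (Y r)) 0 r := by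
    intro r hr
    have hZ : HasDerivAt (fun r => V (Y r)) (-((1 - γ) • V (Y r))) r := by
      have h1 := hasDerivAt_velocity_orbit h (hY r hr)
      rw [hfree r hr, sub_zero] at h1
      exact h1
    have hexp : HasDerivAt (fun r : ℝ => Real.exp ((1 - γ) * r)) ((1 - γ) * Real.exp ((1 - γ) * r)) r := by
      have h1 := ((hasDerivAt_id r).const_mul (1 - γ)).exp
      simp only [id, mul_one] at h1
      convert h1 using 1; ring
    refine (hexp.smul hZ).congr_deriv ?_
    rw [smul_neg, smul_smul, mul_comm (Real.exp ((1 - γ) * r)) (1 - γ), neg_add_cancel]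
  have h1 := eq_of_hasDerivAt_zero_Icc hdrift hσ
  have h2 := eq_of_hasDerivAt_zero_Icc hfall hσ
  simp only [mul_zero, neg_zero, Real.exp_zero, one_smul] at h1 h2
  have e1 : Y σ + V (Y σ) = Real.exp (γ * σ) • (Y 0 + V (Y 0)) := by
    rw [← h1, smul_smul, ← Real.exp_add, show γ * σ + -(γ * σ) = 0 by ring, Real.exp_zero, one_smul]
  have e2 : V (Y σ) = Real.exp ((γ - 1) * σ) • V (Y 0) := by
    rw [← h2, smul_smul, ← Real.exp_add, show (γ - 1) * σ + (1 - γ) * σ = 0 by ring, Real.exp_zero, one_smul]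
  calc Y σ = (Y σ + V (Y σ)) - V (Y σ) := by abel
    _ = Real.exp (γ * σ) • (Y 0 + V (Y 0)) - Real.exp ((γ - 1) * σ) • V (Y 0) := by rw [e1, ← e2]

end Ballistic

end Summit.NavierStokesRegularity.NavierStokesRegularity.Theorems.PowerGaugeEulerLiouville
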